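import Summits.CriticalPhenomena.CardyFormulaZ2.Theses.CardyViaSLE6
import Literature.Probability.RandomPlanarGeometry.CritPercSLEProofs
import Literature.Probability.RandomPlanarGeometry.SLEBoundaryHittingProofs
import Literature.Probability.RandomPlanarGeometry.SLEBoundaryHittingHolds
import Literature.Probability.RandomPlanarGeometry.ConformalMapCaratheodoryProofs
import Literature.Probability.RandomPlanarGeometry.LocalMartingaleProofs
import HarnessLib

/-!
# Route `CardyViaSLE6`: the SLE₆ hitting sandwich (stmt-CriticalPhenomena-8608)

Sub-problem `CriticalPhenomena/CardyFormulaZ2`, route `CardyViaSLE6`, support item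
`Summit.CriticalPhenomena.CardyFormulaZ2.Theses.CardyViaSLE6.SLE6HittingSandwich`: for a conformal
rectangle `R = (Ω; a, b, c, d)` and every SLE₆ law `μ` in `(Ω; a, c)`, for all `ε > 0` there is
`b₀ > 0` such that for `0 < b < b₀` and every `a > 0`

* `μ(hits (cd) before (bc)) ≤ μ("a-close to (cd) at a time up to which it stayed > b from (bc)") + ε`,
* `μ(univ) ≤ μ("a-close to (bc) … > b from (cd)") + μ(hits (cd) before (bc)) + ε`.

Proof.  The first line holds for every finite measure on curve classes and every closed nonempty
avoided set (`exists_forall_measureReal_hitsBefore_le`): the events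
`E_b = {∃ t, γ t ∈ A ∧ ∀ s ≤ t, infDist (γ s) B > b}` increase to `hitsBefore A B` as `b ↓ 0`
(compactness of `[0, t]`), lie inside every approximant `hitsBeforeApprox A B a b`, and measures are
continuous along increasing unions (no measurability needed).  The second line is the first line
for the swapped arcs plus the **`κ > 4` dichotomy** `μ(hits (cd) before (bc)) + μ(hits (bc) before
(cd)) = 1` (`sle_six_measureReal_hitsBefore_add`): pulling the two arcs back to the two closed
real rays `realRay u`, `realRay v` (`u`, `v` of opposite signs) of the chordal uniformizing map
(Carathéodory, `exists_rays_of_isChordalUniformizing_of_disc` with the PROVED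
`exists_continuousOn_extension_holds`), almost surely the two crossing events are `{T_u < T_v}`
and `{T_v < T_u}` (`mk_mem_hitsBefore_iff_firstHit_lt`, swallowing = hitting
`sle_swallowingTime_ofReal_eq_firstHit_holds`), and ties `T_u = T_v` are excluded because the
positive ray is a.s. swallowed in finite time (`sle_swallowingTime_ofReal_lt_top_holds`, `κ = 6 > 4`)
while the rays are disjoint.  (Lawler 2005, Prop. 6.8, Rem. 6.6, Prop. 6.33; Rohde–Schramm 2005,
Thm 6.4; Werner 2007, §3.)
-/

noncomputable section

open Set Filter Topology Metric MeasureTheory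
open scoped NNReal ENNReal unitInterval
open Literature.Probability Literature.Probability.RandomPlanarGeometry

namespace Summit.CriticalPhenomena.CardyFormulaZ2.Theorems.CardyViaSLE6

/-! ### Approximating `hitsBefore A B` from inside by the open approximants -/

/-- For a closed nonempty avoided set `B`, the crossing event `hitsBefore A B` is the increasing
union over `n` of the events "`γ` visits `A` at a time up to which it stayed at distance
`> 1/(n+1)` from `B`" (compactness of the initial time segment). [folklore] -/
theorem hitsBefore_eq_iUnion_far {A B : Set ℂ} (hB : IsClosed B) (hBne : B.Nonempty) :
    CurveClass.hitsBefore A B = ⋃ n : ℕ, CurveClass.mk ''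
      {γ : Curve ℂ | ∃ t, γ t ∈ A ∧ ∀ s ≤ t, 1 / ((n : ℝ) + 1) < infDist (γ s) B} := by
  ext c
  simp only [mem_iUnion]
  constructor
  · rintro ⟨γ, ⟨t, htA, htB⟩, rfl⟩
    have hγc : Continuous γ := γ.toContinuousMap.continuous
    have hcont : Continuous fun s : I ↦ infDist (γ s) B := (continuous_infDist_pt B).comp hγc
    obtain ⟨s₀, hs₀, hmin⟩ :=
      isClosed_Iic.isCompact.exists_isMinOn (nonempty_Iic (a := t)) hcont.continuousOn
    have hpos : 0 < infDist (γ s₀) B := (hB.notMem_iff_infDist_pos hBne).1 (htB s₀ hs₀)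
    obtain ⟨n, hn⟩ := exists_nat_one_div_lt hpos
    exact ⟨n, γ, ⟨t, htA, fun s hs ↦ hn.trans_le ((isMinOn_iff.1 hmin) s hs)⟩, rfl⟩
  · rintro ⟨n, γ, ⟨t, htA, htB⟩, rfl⟩
    refine CurveClass.mk_mem_hitsBefore htA fun s hs hsB ↦ ?_
    have h0 : infDist (γ s) B = 0 := infDist_zero_of_mem hsB
    have := htB s hs
    rw [h0] at this
    have : (0 : ℝ) < 1 / ((n : ℝ) + 1) := by positivity
    linarith

/-- **Inner approximation of the crossing event.**  For a finite measure `μ` on curve classes, any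
`A` and a closed nonempty `B`: for all `ε > 0` there is `b₀ > 0` such that for `0 < b < b₀` and
every `a > 0`, `μ(hitsBefore A B) ≤ μ(mk '' hitsBeforeApprox A B a b) + ε` (continuity of the
measure along the increasing union `hitsBefore_eq_iUnion_far`, whose `n`-th term lies in every
approximant with `b < 1/(n+1)`). [folklore] -/
theorem exists_forall_measureReal_hitsBefore_le (μ : Measure (CurveClass ℂ)) [IsFiniteMeasure μ]
    (A : Set ℂ) {B : Set ℂ} (hB : IsClosed B) (hBne : B.Nonempty) {ε : ℝ} (hε : 0 < ε) :
    ∃ b₀ > (0 : ℝ), ∀ b ∈ Ioo 0 b₀, ∀ a > (0 : ℝ), μ.real (CurveClass.hitsBefore A B) ≤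
      μ.real (CurveClass.mk '' CurveClass.hitsBeforeApprox A B a b) + ε := by
  set E : ℕ → Set (CurveClass ℂ) := fun n ↦ CurveClass.mk ''
    {γ : Curve ℂ | ∃ t, γ t ∈ A ∧ ∀ s ≤ t, 1 / ((n : ℝ) + 1) < infDist (γ s) B} with hE
  have hmono : Monotone E := by
    intro m n hmn
    rintro _ ⟨γ, ⟨t, htA, htB⟩, rfl⟩
    refine ⟨γ, ⟨t, htA, fun s hs ↦ lt_of_le_of_lt ?_ (htB s hs)⟩, rfl⟩
    have : (m : ℝ) + 1 ≤ (n : ℝ) + 1 := by exact_mod_cast Nat.succ_le_succ hmn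
    exact one_div_le_one_div_of_le (by positivity) this
  have hU : CurveClass.hitsBefore A B = ⋃ n, E n := hitsBefore_eq_iUnion_far hB hBne
  have htend : Tendsto (fun n ↦ μ.real (E n)) atTop (𝓝 (μ.real (CurveClass.hitsBefore A B))) := by
    have h := tendsto_measure_iUnion_atTop (μ := μ) hmono
    rw [← hU] at h
    exact (ENNReal.tendsto_toReal (measure_ne_top _ _)).comp h
  obtain ⟨N, hN⟩ := (Metric.tendsto_atTop.1 htend) ε hε
  refine ⟨1 / ((N : ℝ) + 1), by positivity, fun b hb a ha ↦ ?_⟩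
  have hsub : E N ⊆ CurveClass.mk '' CurveClass.hitsBeforeApprox A B a b := by
    rintro _ ⟨γ, ⟨t, htA, htB⟩, rfl⟩
    refine ⟨γ, ⟨t, ?_, fun s hs ↦ hb.2.trans (htB s hs)⟩, rfl⟩
    rw [infDist_zero_of_mem htA]
    exact ha
  have h1 : μ.real (E N) ≤ μ.real (CurveClass.mk '' CurveClass.hitsBeforeApprox A B a b) :=
    measureReal_mono hsub
  have h2 := hN N le_rfl
  rw [Real.dist_eq, abs_sub_lt_iff] at h2
  linarith [h2.1, h2.2]

/-! ### The `κ > 4` dichotomy for the two crossing events -/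

/-- **Dichotomy of the crossing events for SLE₆.**  For a conformal rectangle `R = (Ω; a, b, c, d)`
and every SLE₆ law `μ` in `(Ω; a, c)`: `μ(hits (cd) before (bc)) + μ(hits (bc) before (cd)) = 1`.
Almost surely the two events are `{T_u < T_v}` and `{T_v < T_u}` for the two boundary rays of the
chordal uniformizing map (Carathéodory boundary correspondence, swallowing = hitting), and
`T_u ≠ T_v` a.s. since the positive ray is swallowed in finite time (`κ = 6 > 4`) and the rays are
disjoint. (Lawler 2005, Prop. 6.8 and Rem. 6.6; Rohde–Schramm 2005, Thm 6.4.) [folklore] -/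
theorem sle_six_measureReal_hitsBefore_add (R : ConformalRectangle) {μ : Measure (CurveClass ℂ)}
    (hμ : IsSLELaw 6 (R.chord 0 2 (by decide)) μ) :
    μ.real (CurveClass.hitsBefore (R.arc 2) (R.arc 1)) +
      μ.real (CurveClass.hitsBefore (R.arc 1) (R.arc 2)) = 1 := by
  haveI := isProbabilityMeasure_preWienerMeasure'
  obtain ⟨Γ, ⟨hΓm, ψ, hψ, hae⟩, rfl⟩ := hμ
  obtain ⟨u, v, huv, harc1, harc2, -⟩ :=
    ConformalRectangle.exists_rays_of_isChordalUniformizing_of_disc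
      JordanDomain.exists_continuousOn_extension_holds R hψ
  have h46 : (4 : ℝ≥0) < 6 := by norm_num
  have hpos : 0 < max u v := by
    rcases huv with ⟨-, hv⟩ | ⟨-, hu⟩
    · exact lt_max_of_lt_right hv
    · exact lt_max_of_lt_left hu
  have hu0 : u ≠ 0 := by
    rcases huv with ⟨hu, -⟩ | ⟨-, hu⟩
    · exact hu.ne
    · exact hu.ne'
  have hv0 : v ≠ 0 := by
    rcases huv with ⟨-, hv⟩ | ⟨hv, -⟩
    · exact hv.ne'
    · exact hv.ne
  have hdisj : Disjoint (realRay u) (realRay v) := by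
    rcases huv with ⟨hu, hv⟩ | ⟨hv, hu⟩
    · exact disjoint_realRay hu hv
    · exact (disjoint_realRay hv hu).symm
  -- a.s. finiteness of the swallowing time of the positive ray's base point
  have hfinae : ∀ᵐ ω ∂Process.preWienerMeasure,
      Loewner.swallowingTime (sleDriving 6 ω) ((max u v : ℝ) : ℂ) < ⊤ :=
    (sle_swallowingTime_ofReal_lt_top_holds h46).mono fun _ h ↦ h _ hpos
  -- the a.s. identification of the two crossing events and the exclusion of ties
  set H₁ : Set (CurveClass ℂ) := CurveClass.hitsBefore (R.arc 2) (R.arc 1) with hH₁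
  set H₂ : Set (CurveClass ℂ) := CurveClass.hitsBefore (R.arc 1) (R.arc 2) with hH₂
  set S₁ : Set (ℝ≥0 → ℝ) := {ω | Loewner.swallowingTime (sleDriving 6 ω) u <
    Loewner.swallowingTime (sleDriving 6 ω) v} with hS₁
  set S₂ : Set (ℝ≥0 → ℝ) := {ω | Loewner.swallowingTime (sleDriving 6 ω) v <
    Loewner.swallowingTime (sleDriving 6 ω) u} with hS₂
  have key : ∀ᵐ ω ∂Process.preWienerMeasure,
      (ω ∈ Γ ⁻¹' H₁ ↔ ω ∈ S₁) ∧ (ω ∈ Γ ⁻¹' H₂ ↔ ω ∈ S₂) ∧ (ω ∈ S₁ ∨ ω ∈ S₂) := by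
    filter_upwards [hae, hfinae] with ω hω hfinω
    obtain ⟨hgen, c, hΓc, hc⟩ := hω
    have hTu := sle_swallowingTime_ofReal_eq_firstHit_holds 6 ω hgen hu0
    have hTv := sle_swallowingTime_ofReal_eq_firstHit_holds 6 ω hgen hv0
    have hfin : firstHit (sleTrace 6 ω) (realRay u) < ⊤ ∨
        firstHit (sleTrace 6 ω) (realRay v) < ⊤ := by
      rcases huv with ⟨hu, hv⟩ | ⟨hv, hu⟩
      · right
        rw [← hTv, ← max_eq_right (hu.trans hv).le]
        exact hfinω
      · left
        rw [← hTu, ← max_eq_left (hv.trans hu).le]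
        exact hfinω
    have hiff₁ := mk_mem_hitsBefore_iff_firstHit_lt (R.isClosed_arc 1)
      (isClosed_realRay u) (isClosed_realRay v) hdisj hgen.continuous
      (fun t ↦ harc2 _ (hgen.im_nonneg t)) (fun t ↦ harc1 _ (hgen.im_nonneg t)) hc hfin
    have hiff₂ := mk_mem_hitsBefore_iff_firstHit_lt (R.isClosed_arc 2)
      (isClosed_realRay v) (isClosed_realRay u) hdisj.symm hgen.continuous
      (fun t ↦ harc1 _ (hgen.im_nonneg t)) (fun t ↦ harc2 _ (hgen.im_nonneg t)) hc hfin.symm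
    refine ⟨?_, ?_, ?_⟩
    · change Γ ω ∈ CurveClass.hitsBefore (R.arc 2) (R.arc 1) ↔
        Loewner.swallowingTime (sleDriving 6 ω) u < Loewner.swallowingTime (sleDriving 6 ω) v
      rw [hΓc, hTu, hTv]
      exact hiff₁
    · change Γ ω ∈ CurveClass.hitsBefore (R.arc 1) (R.arc 2) ↔
        Loewner.swallowingTime (sleDriving 6 ω) v < Loewner.swallowingTime (sleDriving 6 ω) u
      rw [hΓc, hTu, hTv]
      exact hiff₂
    · -- no ties: both times finite would place one point of the trace on two disjoint rays
      change Loewner.swallowingTime (sleDriving 6 ω) u < Loewner.swallowingTime (sleDriving 6 ω) v ∨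
        Loewner.swallowingTime (sleDriving 6 ω) v < Loewner.swallowingTime (sleDriving 6 ω) u
      rw [hTu, hTv]
      rcases lt_trichotomy (firstHit (sleTrace 6 ω) (realRay u))
        (firstHit (sleTrace 6 ω) (realRay v)) with hlt | heq | hgt
      · exact Or.inl hlt
      · exfalso
        have hfu : firstHit (sleTrace 6 ω) (realRay u) ≠ ⊤ := by
          rcases hfin with h | h
          · exact h.ne
          · exact (heq ▸ h).ne
        obtain ⟨t₀, ht₀, hγt₀⟩ := exists_firstHit_eq_coe hgen.continuous (isClosed_realRay u) hfu
        obtain ⟨t₁, ht₁, hγt₁⟩ :=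
          exists_firstHit_eq_coe hgen.continuous (isClosed_realRay v) (heq ▸ hfu)
        have h01 : t₀ = t₁ := WithTop.coe_injective (ht₀.symm.trans (heq.trans ht₁))
        exact hdisj.ne_of_mem hγt₀ hγt₁ (by rw [h01])
      · exact Or.inr hgt
  -- measure bookkeeping
  have hmeasH₁ : MeasurableSet H₁ :=
    CurveClass.measurableSet_hitsBefore_holds (R.isClosed_arc 2) (R.isClosed_arc 1)
  have hmeasH₂ : MeasurableSet H₂ :=
    CurveClass.measurableSet_hitsBefore_holds (R.isClosed_arc 1) (R.isClosed_arc 2)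
  have hdisjae : AEDisjoint Process.preWienerMeasure (Γ ⁻¹' H₁) (Γ ⁻¹' H₂) := by
    rw [AEDisjoint]
    refine measure_eq_zero_iff_ae_notMem.2 (key.mono fun ω hω h ↦ ?_)
    obtain ⟨h₁, h₂, -⟩ := hω
    have hs₁ : Loewner.swallowingTime (sleDriving 6 ω) u <
        Loewner.swallowingTime (sleDriving 6 ω) v := h₁.1 h.1
    have hs₂ : Loewner.swallowingTime (sleDriving 6 ω) v <
        Loewner.swallowingTime (sleDriving 6 ω) u := h₂.1 h.2
    exact lt_asymm hs₁ hs₂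
  have hunion : Process.preWienerMeasure (Γ ⁻¹' H₁ ∪ Γ ⁻¹' H₂) = 1 := by
    rw [← measure_univ (μ := Process.preWienerMeasure)]
    refine measure_congr (ae_eq_univ.2 ?_)
    refine measure_eq_zero_iff_ae_notMem.2 (key.mono fun ω hω h ↦ ?_)
    obtain ⟨h₁, h₂, h₃⟩ := hω
    rcases h₃ with hs | hs
    · exact h (Or.inl (h₁.2 hs))
    · exact h (Or.inr (h₂.2 hs))
  rw [measureReal_def, measureReal_def, Measure.map_apply_of_aemeasurable hΓm hmeasH₁,
    Measure.map_apply_of_aemeasurable hΓm hmeasH₂,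
    ← ENNReal.toReal_add (measure_ne_top _ _) (measure_ne_top _ _),
    ← measure_union₀ (hΓm.nullMeasurableSet_preimage hmeasH₂) hdisjae, hunion, ENNReal.toReal_one]

/-! ### The sandwich -/

/-- **The SLE₆ hitting sandwich** (support item stmt-CriticalPhenomena-8608 of route `CardyViaSLE6`),
proved: the first line is the inner approximation `exists_forall_measureReal_hitsBefore_le` at
`(A, B) = ((cd), (bc))`; the second is the same at `((bc), (cd))` combined with the dichotomy
`sle_six_measureReal_hitsBefore_add`. (Lawler 2005, Prop. 6.33; Rohde–Schramm 2005, Thm 6.4;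
Werner 2007, §3 Lemma 3.2.) [folklore] -/
theorem sle6HittingSandwich_proof : Theses.CardyViaSLE6.SLE6HittingSandwich := by
  intro R μ hμ ε hε
  haveI : Fact Process.isProjectiveLimit_preWienerMeasure := ⟨isProjectiveLimit_preWienerMeasure_holds⟩
  haveI : IsProbabilityMeasure μ := hμ.isProbabilityMeasure
  have hne₁ : (R.arc 1).Nonempty := ⟨_, R.pt_mem_arc_self 1⟩
  have hne₂ : (R.arc 2).Nonempty := ⟨_, R.pt_mem_arc_self 2⟩
  obtain ⟨b₁, hb₁, h₁⟩ :=
    exists_forall_measureReal_hitsBefore_le μ (R.arc 2) (R.isClosed_arc 1) hne₁ hε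
  obtain ⟨b₂, hb₂, h₂⟩ :=
    exists_forall_measureReal_hitsBefore_le μ (R.arc 1) (R.isClosed_arc 2) hne₂ hε
  have hadd := sle_six_measureReal_hitsBefore_add R hμ
  have huniv : μ.real univ = 1 := probReal_univ
  refine ⟨min b₁ b₂, lt_min hb₁ hb₂, fun b hb a ha ↦ ⟨?_, ?_⟩⟩
  · exact h₁ b ⟨hb.1, hb.2.trans_le (min_le_left _ _)⟩ a ha
  · have := h₂ b ⟨hb.1, hb.2.trans_le (min_le_right _ _)⟩ a ha
    linarith

end Summit.CriticalPhenomena.CardyFormulaZ2.Theorems.CardyViaSLE6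

end
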